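import Summits.ABC.IUTFork.Cor312SettingDHVol
import Summits.ABC.IUTFork.Cor312FactorMapLattice
import HarnessLib

/-!
# [IUTchIII] Corollary 3.12 over the REAL log-shells with the VERBATIM volumes — the Dupuy–Hilado Θ-BOXES:
# `hθ` (the (Ind3)-enlarged Θ-region is admissible) and `hfinθ` (finitely supported log-volume) for boxes cut
# out summand by summand

Record-only file (D-0012) of the abc-iut cell (Cor. 3.12 sub-crew, seat abc-iut-c312-3 = the L-DH level, gen 4;
D-0067 TEAM A row A-0); TAKES NO SIDE. abc-iut-c312-5's `Cor312SettingDHVol` assembles c312-7's `Cor312.Setting`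
of the printed statement of [IUTchIII] Cor. 3.12 (kurims `paper:url-4b091feeb646` p. 173 l. 41 – p. 174 l. 19) over
the real Dupuy–Hilado-level log-shells of a number field `F` with the VERBATIM admissible regions and log-volumes of
[IUTchIII] Rmk. 3.1.1 (ii)(iii) (`Real.situationDHVol`), proves `hadm`/`hul_nonempty`, and names the binders it
leaves: the Θ-boxes `thetaBox` ("owner c312-3 `Ind3Datum`") with `hθ`/`hfinθ`, the `q`-centre with `hq`/`hfin`,
and `ThetaFinite` (c312-7). THIS file treats the Θ-boxes at the Dupuy–Hilado level, for ANY family of per-summand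
regions (the sharp reading read off ideles and the `q`-centre: `Cor312PilotIdelesDH`):

* §1 (generic, any `p`-adic presentation): `boxOf U` — the region of the field-factor product `Π_{(v⃗,i)} L_{v⃗,i}`
  cut out summand by summand by regions `U_{v⃗} ⊆ X_{v⃗} = F_{v_0} ⊗_{ℚ_p} ⋯ ⊗ F_{v_j}` through abc-iut-c312-3's
  decompositions `ψ_{v⃗}` (`dEquiv`, [IUTchIV] Prop. 1.4 (i)); its preimage under the field-factor comparison is
  the `e`-preimage of the DIRECT PRODUCT OVER THE SUMMANDS `Π_{v⃗} U_{v⃗}` (`factorMap_preimage_boxOf`), hence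
  ADMISSIBLE in the verbatim container as soon as every `U_{v⃗}` has positive finite Haar measure
  (`adm_preimage_boxOf`; [IUTchIII] Rmk. 3.1.1 (iii)); dually `centreOf g`, whose hull-set `λ·𝒪_L` pulls back to
  `Π_{v⃗} g_{v⃗}·(R_I)^∼` (`factorMap_preimage_hullSet_centreOf`; Rmk. 3.9.5 (ii)).
* §2 (the DH boxes): `thetaBoxDH B` for a family of per-summand regions `B` (at `∞` everything: the parent files'
  trivial archimedean container `LocalPieces.trivial` — a MODELLING CHOICE of `Cor312VolumesRealAssembly`, not
  Dupuy–Hilado's Def. 3.6.1, which keeps `p = ∞`), CONSTANT in the Kummer index `m` — arXiv:2004.13228 §4.10 renders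
  (Ind3) ([IUTchIII] Thm. 3.11 (ii), p. 156: the Kummer isomorphisms are "upper semi-compatible" as `m` varies) by
  ONE admissible region `(𝒪_𝕃(−P_Θ))^{Ind3}` standing for the union of the Kummer images, so c312-7's
  `thetaRegion3 = ⋃ₘ thetaRegion m` IS that region (`thetaRegion3_thetaBoxDH`); then `hθ` for admissible `B`
  (`adm_thetaRegion3_thetaBoxDH`), the log-volume `Σ_{v⃗} w_{v⃗}·log μ̄_{v⃗}(B_{v⃗})` at a prime
  (`logvol_thetaRegion3_thetaBoxDH_inr`; `0` at `∞`, `logvol_situationDHVol_inl`), and `hfinθ` from finitely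
  many primes carrying a summand of non-zero log-measure (`finite_support_logvol_thetaRegion3_thetaBoxDH`); the primes under
  `S` are such a finite set (`finite_primes_under_S`). The `m`-CONSTANT case is the positive bracket of
  abc-iut-w5-d060's `Cor312ThetaRegion3UnionNotAdm`: an `m`-VARYING family with coordinate-separated product images
  is NOT admissible in this container (a union of boxes is not a box), so `hθ` genuinely constrains the Θ-images.
[claim: Mochizuki2012, status: disputed] for the quoted setting; [cite: DupuyHilado2025, Def. 3.6.1, Def. 3.6.3,
§4.10]; [cite: Mochizuki2012, IUTchIII Rmk. 3.1.1 (iii) p. 96, Rmk. 3.9.5 (ii) p. 127, IUTchIV Prop. 1.4 (i) p. 13].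
Nothing here asserts that Cor. 3.12 holds or chooses a reading of (Ind3): the sharp region `𝒪_𝕃(−P_Θ)` and any
(4.10)-bounded region between it and `⋃ₙ t_Θⁿ·I` (abc-iut-c312-3 `Ind3Datum`) are both instances of `B`.
An instance ≠ an endorsement.
-/

noncomputable section

open Set Function NumberField IsDedekindDomain
open scoped Pointwise

namespace Summit.ABC

namespace IUTFork

namespace Cor312Vol

namespace PadicPresentation

open Thm311 Literature.IUT.LogThetaLattice Literature.IUT.LogVolume

variable {T : ThetaIndex} {L : LogShells T} {vQ : T.VQ} {p : ℕ} [Fact p.Prime] (P : PadicPresentation L vQ p)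

/-! ## §1. Boxes of the field-factor product cut out summand by summand -/

/-- **The box of `Π_{(v⃗,i)} L_{v⃗,i}` determined by per-summand regions `U_{v⃗} ⊆ X_{v⃗}`**: the tuples whose
`v⃗`-block `(y_{v⃗,i})_i` is the image under c312-3's decomposition `ψ_{v⃗}` of a point of `U_{v⃗}` ([IUTchIV] Prop.
1.4 (i): `X_{v⃗} ≅ ⊕_i L_{v⃗,i}`). [cite: Mochizuki2012, IUTchIV Prop. 1.4 (i) p. 13] -/
def boxOf {j : T.Label} (U : ∀ e : T.Caps j → T.Fibre vQ, Set (P.X e)) :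
    Set (∀ s : P.factorIdx j, P.factorField j s) :=
  {y | ∀ e, ∃ x ∈ U e, ∀ i, y ⟨e, i⟩ = dEquiv p (P.kk e) x i}

/-- The field-factor comparison at the factor `(v⃗, i)` is the `i`-th component of `ψ_{v⃗}(e(x)_{v⃗})`. [folklore] -/
theorem factorMap_mk {j : T.Label} (x : L.Packet j vQ) (e : T.Caps j → T.Fibre vQ) (i : DIdx p (P.kk e)) :
    P.factorMap j x ⟨e, i⟩ = dEquiv p (P.kk e) (P.comparison j x e) i :=
  rfl

/-- **The preimage of a box is the direct product over the SUMMANDS**: `(ψ ∘ e)⁻¹(boxOf U) = e⁻¹(Π_{v⃗} U_{v⃗})`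
(`ψ_{v⃗}` is injective). [cite: Mochizuki2012, IUTchIII Rmk. 3.1.1 (iii) p. 96] -/
theorem factorMap_preimage_boxOf {j : T.Label} (U : ∀ e : T.Caps j → T.Fibre vQ, Set (P.X e)) :
    (fun x => P.factorMap j x) ⁻¹' P.boxOf U = P.comparison j ⁻¹' Set.pi univ U := by
  ext x
  simp only [Set.mem_preimage, boxOf, Set.mem_setOf_eq, Set.mem_univ_pi, factorMap_mk]
  refine forall_congr' fun e => ⟨?_, fun hx => ⟨_, hx, fun _ => rfl⟩⟩
  rintro ⟨x', hx', h⟩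
  rw [(dEquiv p (P.kk e)).injective (funext h)]
  exact hx'

/-- **A box of admissible summand regions pulls back to an ADMISSIBLE region of the verbatim container** (a direct
product over the summands of sets of positive finite normalised Haar measure, [IUTchIII] Rmk. 3.1.1 (iii)).
[cite: Mochizuki2012, IUTchIII Rmk. 3.1.1 (iii) p. 96] -/
theorem adm_preimage_boxOf {j : T.Label} {U : ∀ e : T.Caps j → T.Fibre vQ, Set (P.X e)}
    (hU : ∀ e, PacketAdm p (P.kk e) (U e)) :
    P.toLocalPieces.Adm j ((fun x => P.factorMap j x) ⁻¹' P.boxOf U) := by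
  rw [factorMap_preimage_boxOf]
  exact ⟨U, Set.image_preimage_eq _ (P.comparison_surjective j), hU⟩

/-- Hence the image of the preimage of a box is the box. [folklore] -/
theorem image_factorMap_preimage_boxOf {j : T.Label} (U : ∀ e : T.Caps j → T.Fibre vQ, Set (P.X e)) :
    (fun x => P.factorMap j x) '' ((fun x => P.factorMap j x) ⁻¹' P.boxOf U) = P.boxOf U :=
  Set.image_preimage_eq _ (P.factorMap_surjective j)

/-- **The centre `λ ∈ Π_{(v⃗,i)} L_{v⃗,i}` determined by elements `g_{v⃗} ∈ X_{v⃗}`**: `λ_{v⃗,i} = ψ_{v⃗}(g_{v⃗})_i`.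
[cite: Mochizuki2012, IUTchIII Rmk. 3.9.5 (ii) p. 127] -/
def centreOf {j : T.Label} (g : ∀ e : T.Caps j → T.Fibre vQ, P.X e) : ∀ s : P.factorIdx j, P.factorField j s :=
  fun s => dEquiv p (P.kk s.1) (g s.1) s.2

/-- `ψ_{v⃗}⁻¹(ψ_{v⃗}(g)·𝒪) = g·(R_I)^∼` for nondegenerate `g` (`ψ((R_I)^∼)` is the unit polydisc).
[cite: Mochizuki2012, IUTchIV Prop. 1.4 (i) p. 13] -/
theorem preimage_dEquiv_hullSet {j : T.Label} (e : T.Caps j → T.Fibre vQ) (g : P.X e)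
    (hg : ∀ i, dEquiv p (P.kk e) g i ≠ 0) :
    dEquiv p (P.kk e) ⁻¹' hullSet (DFac p (P.kk e)) (dEquiv p (P.kk e) g) =
      g • (normalizedPacket p (P.kk e) : Set (P.X e)) := by
  haveI : Nonempty (T.Caps j) := ⟨0⟩
  rw [← Set.preimage_image_eq (g • (normalizedPacket p (P.kk e) : Set (P.X e))) (dEquiv p (P.kk e)).injective,
    image_smul_eq, image_normalizedPacket_eq_coe, coe_piUnitBallStructure, hullSet_eq_image_mul _ _ hg]

/-- **The hull-set `λ·𝒪_L` of the centre `centreOf g` pulls back to `e⁻¹(Π_{v⃗} g_{v⃗}·(R_I)^∼)`**.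
[cite: Mochizuki2012, IUTchIII Rmk. 3.9.5 (ii) p. 127] -/
theorem factorMap_preimage_hullSet_centreOf {j : T.Label} (g : ∀ e : T.Caps j → T.Fibre vQ, P.X e)
    (hg : ∀ e i, dEquiv p (P.kk e) (g e) i ≠ 0) :
    (fun x => P.factorMap j x) ⁻¹' hullSet (P.factorField j) (P.centreOf g) =
      P.comparison j ⁻¹' Set.pi univ fun e => g e • (normalizedPacket p (P.kk e) : Set (P.X e)) := by
  rw [factorMap_preimage_hullSet]
  congr 1
  refine Set.pi_congr rfl fun e _ => ?_
  exact P.preimage_dEquiv_hullSet e (g e) (hg e)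

/-- **A box of translated unit balls is a hull-set**: `boxOf (g_{v⃗}·(R_I)^∼)_{v⃗} = λ·𝒪_L` with `λ = centreOf g`
(`ψ_{v⃗}(g_{v⃗}·(R_I)^∼)` is the polydisc of radii `‖ψ_{v⃗}(g_{v⃗})_i‖`). [cite: Mochizuki2012, IUTchIII Rmk. 3.9.5 (ii) p. 127] -/
theorem boxOf_smul_normalizedPacket {j : T.Label} (g : ∀ e : T.Caps j → T.Fibre vQ, P.X e)
    (hg : ∀ e i, dEquiv p (P.kk e) (g e) i ≠ 0) :
    P.boxOf (fun e => g e • (normalizedPacket p (P.kk e) : Set (P.X e))) =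
      hullSet (P.factorField j) (P.centreOf g) := by
  ext y
  simp only [boxOf, Set.mem_setOf_eq, hullSet, mem_polydisc, Sigma.forall]
  refine forall_congr' fun e => ?_
  rw [← P.preimage_dEquiv_hullSet e (g e) (hg e)]
  constructor
  · rintro ⟨x, hx, hy⟩ i
    rw [hy i]
    exact (mem_polydisc _).1 hx i
  · intro hy
    refine ⟨(dEquiv p (P.kk e)).symm fun i => y ⟨e, i⟩, ?_, fun i => ?_⟩
    · rw [Set.mem_preimage, AlgEquiv.apply_symm_apply]
      exact (mem_polydisc _).2 hy
    · rw [AlgEquiv.apply_symm_apply]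

/-- … so the image under the field-factor comparison of `e⁻¹(Π_{v⃗} g_{v⃗}·(R_I)^∼)` IS the hull-set `λ·𝒪_L`,
`λ = centreOf g` — in particular a hull-set ([IUTchIII] Rmk. 3.9.5 (ii)). [cite: Mochizuki2012, IUTchIII Rmk. 3.9.5 (ii) p. 127] -/
theorem image_factorMap_preimage_boxOf_smul {j : T.Label} (g : ∀ e : T.Caps j → T.Fibre vQ, P.X e)
    (hg : ∀ e i, dEquiv p (P.kk e) (g e) i ≠ 0) :
    (fun x => P.factorMap j x) '' ((fun x => P.factorMap j x) ⁻¹'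
        P.boxOf fun e => g e • (normalizedPacket p (P.kk e) : Set (P.X e))) =
      hullSet (P.factorField j) (P.centreOf g) := by
  rw [image_factorMap_preimage_boxOf, boxOf_smul_normalizedPacket _ g hg]

end PadicPresentation

end Cor312Vol

namespace Thm311

namespace Real

open Cor312 Cor312Vol Literature.IUT.LogThetaLattice Literature.IUT.LogVolume

variable {F : Type} [Field F] [NumberField F] (X : PilotData F) {logv : PadicLogs F} (hlog : LogvAnalytic logv)

/-! ## §2. The Dupuy–Hilado Θ-boxes from per-summand regions; `hθ`, the log-volume, finite support -/

/-- **The Dupuy–Hilado Θ-boxes** of the field-factor product determined by per-summand regions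
`B_{p,j,v⃗} ⊆ X_{v⃗}` (at a prime: `boxOf`; at `∞`: everything — the parent files' trivial archimedean container, a
modelling choice of `Cor312VolumesRealAssembly`, not Dupuy–Hilado's Def. 3.6.1, which keeps `p = ∞`). They do not
depend on the Kummer index `m` — Dupuy–Hilado §4.10 renders (Ind3) by ONE admissible region
`(𝒪_𝕃(−P_Θ))^{Ind3} ⊇ 𝒪_𝕃(−P_Θ)` standing for the union of the Kummer images — nor on the abstract Θ-pilot object of
the Frobenioid signature (`settingDHVol` feeds them as `fun _ _ => thetaBoxDH B`): at the Dupuy–Hilado level that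
object enters only through its degrees `P_Θ`, which the pilot data `X` records (abc-iut-c312-8 `IsPilotDataOf`).
[claim: Mochizuki2012, status: disputed] -/
def thetaBoxDH (B : ∀ (pp : Nat.Primes) (j : (thetaIndex X).Label)
      (e : (thetaIndex X).Caps j → (thetaIndex X).Fibre (.inr pp)),
      haveI : Fact (pp : ℕ).Prime := ⟨pp.2⟩; Set ((presAt X hlog pp).X e)) :
    ∀ (j : (thetaIndex X).Label) (vQ : (thetaIndex X).VQ),
      Set (∀ s : factorIdxDH X hlog j vQ, factorFieldDH X hlog j vQ s)
  | _, .inl _ => Set.univ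
  | j, .inr pp => haveI : Fact (pp : ℕ).Prime := ⟨pp.2⟩; (presAt X hlog pp).boxOf (B pp j)

section Boxes

variable (B : ∀ (pp : Nat.Primes) (j : (thetaIndex X).Label)
    (e : (thetaIndex X).Caps j → (thetaIndex X).Fibre (.inr pp)),
    haveI : Fact (pp : ℕ).Prime := ⟨pp.2⟩; Set ((presAt X hlog pp).X e))
  (M : Type) [Field M] [NumberField M]
  (archPk : ∀ (j : (thetaIndex X).Label) (vQ : (thetaIndex X).VQ), Set ((logShellsDH X logv).Packet j vQ))
  (archSub : ∀ (j : (thetaIndex X).Label) (v : (thetaIndex X).V),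
    Set ((logShellsDH X logv).Packet j ((thetaIndex X).over v)))
  (Ψ : ℤ → ∀ v : (thetaIndex X).V, v ∈ (thetaIndex X).Vbad → Set ((logShellsDH X logv).StarPacket v))
  (act : ℤ → ∀ v : (thetaIndex X).V, v ∈ (thetaIndex X).Vbad →
    (logShellsDH X logv).StarPacket v → Module.End ℚ ((logShellsDH X logv).StarPacket v))
  (Mmod : ℤ → ∀ j : (thetaIndex X).LabelStar, Set ((logShellsDH X logv).GlobalPacket j.1))
  (region : ℤ → ∀ j : (thetaIndex X).LabelStar, FinDivisor M → ∀ vQ : (thetaIndex X).VQ,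
    Set ((logShellsDH X logv).Packet j.1 vQ))
  (n : ℤ) {HT : Type} {LogLink : HT → HT → Type} {IsFull : ∀ {s t : HT}, LogLink s t → Prop}
  (lat : LGPGaussianLogThetaLattice LogLink IsFull)
  {Frd : Type} {IsoF : Frd → Frd → Type} {Ob : Frd → Type} {realify : Frd → Frd} {Strip : Type}
  {IsoS : Strip → Strip → Type} {Mv : ∀ v : (thetaIndex X).V, v ∈ (thetaIndex X).Vbad → Type}
  [∀ v h, Monoid (Mv v h)]
  (sig : GlobalLGPFrobenioidSignature (thetaIndex X).lstar (thetaIndex X).V (· ∈ (thetaIndex X).Vbad)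
    Frd IsoF Ob realify Strip IsoS Mv)
  (split : SplittingMonoids Mv) {ObΔ : Type} {N : ∀ v : (thetaIndex X).V, v ∈ (thetaIndex X).Vbad → Type}
  [∀ v h, Monoid (N v h)] (qData : QPilotData ObΔ N)
  (qCentre : ObΔ → ∀ (j : (thetaIndex X).Label) (vQ : (thetaIndex X).VQ),
    ∀ s : factorIdxDH X hlog j vQ, factorFieldDH X hlog j vQ s)
  (hq : ∀ j vQ s, qCentre (qPilotObject qData) j vQ s ≠ 0)
  (hfin : ∀ j : (thetaIndex X).Label, (Function.support fun vQ =>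
    ((situationDHVol X hlog M archPk archSub Ψ act Mmod region).D n).logvol j vQ
      (factorMapDH X hlog j vQ ⁻¹' hullSet (factorFieldDH X hlog j vQ) (qCentre (qPilotObject qData) j vQ))).Finite)

/-- The log-volume of the verbatim container at the archimedean place is `0` on every region (the trivial
archimedean container `LocalPieces.trivial` of `Cor312VolumesRealAssembly` — a modelling choice, weights `0`). [folklore] -/
theorem logvol_situationDHVol_inl (u : Unit) (j : (thetaIndex X).Label)
    (A : Set ((logShellsDH X logv).Packet j (.inl u))) :
    ((situationDHVol X hlog M archPk archSub Ψ act Mmod region).D n).logvol j (.inl u) A = 0 := by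
  show ∑ e, (summandPiecesDH X hlog).w j (.inl u) e * _ = 0
  exact Finset.sum_eq_zero fun e _ => by
    rw [show (summandPiecesDH X hlog).w j (.inl u) e = 0 from rfl, zero_mul]

/-- **In the assembled setting with the DH boxes, the (Ind3)-enlarged Θ-region `⋃ₘ thetaRegion m` IS the preimage
of the single box** (the boxes do not depend on `m`). [cite: DupuyHilado2025, §4.10] -/
theorem thetaRegion3_thetaBoxDH (j : (thetaIndex X).Label) (vQ : (thetaIndex X).VQ) :
    (settingDHVol X hlog M archPk archSub Ψ act Mmod region n lat sig split qData
        (fun _ _ => thetaBoxDH X hlog B) qCentre hq hfin).thetaRegion3 j vQ =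
      factorMapDH X hlog j vQ ⁻¹' thetaBoxDH X hlog B j vQ := by
  ext x
  rw [Setting.thetaRegion3, Set.mem_iUnion]
  exact ⟨fun ⟨_, h⟩ => h, fun h => ⟨0, h⟩⟩

/-- **`hθ` for the DH boxes**: if every summand region `B_{p,j,v⃗}` has positive finite Haar measure, the
(Ind3)-enlarged Θ-region of the assembled setting is ADMISSIBLE in the verbatim container at every `(j, v_ℚ)` — at a
prime it is the direct product over the summands of the `B_{p,j,v⃗}` ([IUTchIII] Rmk. 3.1.1 (iii)), at `∞` it is
everything. [claim: Mochizuki2012, status: disputed] -/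
theorem adm_thetaRegion3_thetaBoxDH
    (hB : ∀ (pp : Nat.Primes) (j : (thetaIndex X).Label)
      (e : (thetaIndex X).Caps j → (thetaIndex X).Fibre (.inr pp)),
      haveI : Fact (pp : ℕ).Prime := ⟨pp.2⟩; PacketAdm pp.1 ((presAt X hlog pp).kk e) (B pp j e))
    (j : (thetaIndex X).Label) (vQ : (thetaIndex X).VQ) :
    ((situationDHVol X hlog M archPk archSub Ψ act Mmod region).D n).Adm j vQ
      ((settingDHVol X hlog M archPk archSub Ψ act Mmod region n lat sig split qData
        (fun _ _ => thetaBoxDH X hlog B) qCentre hq hfin).thetaRegion3 j vQ) := by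
  rw [thetaRegion3_thetaBoxDH]
  cases vQ with
  | inl u =>
    refine (LocalPieces.adm_trivial_iff (logShellsDH X logv) (.inl u) j _).2 ⟨0, ?_⟩
    exact Set.mem_univ _
  | inr pp =>
    haveI : Fact (pp : ℕ).Prime := ⟨pp.2⟩
    exact (presAt X hlog pp).adm_preimage_boxOf (hB pp j)

/-- **The log-volume of the (Ind3)-enlarged Θ-region at a prime** is the normalized weighted sum
`Σ_{v⃗} w_{v⃗}·log μ̄_{v⃗}(B_{p,j,v⃗})` over the summands ([IUTchIII] Rmk. 3.1.1 (ii); Prop. 3.9 (i)).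
[claim: Mochizuki2012, status: disputed] -/
theorem logvol_thetaRegion3_thetaBoxDH_inr
    (hB : ∀ (pp : Nat.Primes) (j : (thetaIndex X).Label)
      (e : (thetaIndex X).Caps j → (thetaIndex X).Fibre (.inr pp)),
      haveI : Fact (pp : ℕ).Prime := ⟨pp.2⟩; PacketAdm pp.1 ((presAt X hlog pp).kk e) (B pp j e))
    (j : (thetaIndex X).Label) (pp : Nat.Primes) :
    ((situationDHVol X hlog M archPk archSub Ψ act Mmod region).D n).logvol j (.inr pp)
      ((settingDHVol X hlog M archPk archSub Ψ act Mmod region n lat sig split qData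
        (fun _ _ => thetaBoxDH X hlog B) qCentre hq hfin).thetaRegion3 j (.inr pp)) =
      haveI : Fact (pp : ℕ).Prime := ⟨pp.2⟩
      ∑ e : (presAt X hlog pp).toLocalPieces.E j,
        weightDH X j * packetLogμ pp.1 ((presAt X hlog pp).kk e) (B pp j e) := by
  haveI : Fact (pp : ℕ).Prime := ⟨pp.2⟩
  rw [thetaRegion3_thetaBoxDH]
  have h := (presAt X hlog pp).factorMap_preimage_boxOf (B pp j)
  have key := SummandPieces.logvol_preimage_pi (summandPiecesDH X hlog) j (.inr pp) (R := B pp j) (hB pp j)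
  change (summandPiecesDH X hlog).logvol j (.inr pp)
    ((fun x => (presAt X hlog pp).factorMap j x) ⁻¹' (presAt X hlog pp).boxOf (B pp j)) = _
  rw [h]
  exact key

/-- The support of `v_ℚ ↦ log-volume of the (Ind3)-enlarged Θ-region at (j, v_ℚ)` lies among the primes carrying
a summand of non-zero log-measure. [folklore] -/
theorem support_logvol_thetaRegion3_thetaBoxDH_subset
    (hB : ∀ (pp : Nat.Primes) (j : (thetaIndex X).Label)
      (e : (thetaIndex X).Caps j → (thetaIndex X).Fibre (.inr pp)),
      haveI : Fact (pp : ℕ).Prime := ⟨pp.2⟩; PacketAdm pp.1 ((presAt X hlog pp).kk e) (B pp j e))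
    (j : (thetaIndex X).Label) :
    (Function.support fun vQ =>
      ((situationDHVol X hlog M archPk archSub Ψ act Mmod region).D n).logvol j vQ
        ((settingDHVol X hlog M archPk archSub Ψ act Mmod region n lat sig split qData
          (fun _ _ => thetaBoxDH X hlog B) qCentre hq hfin).thetaRegion3 j vQ)) ⊆
      Sum.inr '' {pp : Nat.Primes | haveI : Fact (pp : ℕ).Prime := ⟨pp.2⟩;
        ∃ e : (thetaIndex X).Caps j → (thetaIndex X).Fibre (.inr pp),
          packetLogμ pp.1 ((presAt X hlog pp).kk e) (B pp j e) ≠ 0} := by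
  intro vQ hvQ
  rw [Function.mem_support] at hvQ
  cases vQ with
  | inl u => exact absurd (logvol_situationDHVol_inl X hlog M archPk archSub Ψ act Mmod region n u j _) hvQ
  | inr pp =>
    refine ⟨pp, ?_, rfl⟩
    haveI : Fact (pp : ℕ).Prime := ⟨pp.2⟩
    by_contra hall
    simp only [Set.mem_setOf_eq, not_exists, not_not] at hall
    apply hvQ
    rw [logvol_thetaRegion3_thetaBoxDH_inr X hlog B M archPk archSub Ψ act Mmod region n lat sig split qData
      qCentre hq hfin hB j pp]
    exact Finset.sum_eq_zero fun e _ => by rw [hall e, mul_zero]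

/-- **`hfinθ` for the DH boxes**: if only finitely many primes carry a summand region of non-zero log-measure at
the label `j`, the log-volume of the (Ind3)-enlarged Θ-region at `j` is finitely supported over `V_ℚ` ([IUTchIII]
Prop. 3.9 (iii): the global log-volume is a finite sum). [claim: Mochizuki2012, status: disputed] -/
theorem finite_support_logvol_thetaRegion3_thetaBoxDH
    (hB : ∀ (pp : Nat.Primes) (j : (thetaIndex X).Label)
      (e : (thetaIndex X).Caps j → (thetaIndex X).Fibre (.inr pp)),
      haveI : Fact (pp : ℕ).Prime := ⟨pp.2⟩; PacketAdm pp.1 ((presAt X hlog pp).kk e) (B pp j e))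
    (j : (thetaIndex X).Label)
    (hB0 : {pp : Nat.Primes | haveI : Fact (pp : ℕ).Prime := ⟨pp.2⟩;
      ∃ e : (thetaIndex X).Caps j → (thetaIndex X).Fibre (.inr pp),
        packetLogμ pp.1 ((presAt X hlog pp).kk e) (B pp j e) ≠ 0}.Finite) :
    (Function.support fun vQ =>
      ((situationDHVol X hlog M archPk archSub Ψ act Mmod region).D n).logvol j vQ
        ((settingDHVol X hlog M archPk archSub Ψ act Mmod region n lat sig split qData
          (fun _ _ => thetaBoxDH X hlog B) qCentre hq hfin).thetaRegion3 j vQ)).Finite :=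
  (hB0.image _).subset (support_logvol_thetaRegion3_thetaBoxDH_subset X hlog B M archPk archSub Ψ act Mmod region n lat sig
    split qData qCentre hq hfin hB j)

end Boxes

/-- The rational primes lying under a place of `S` — a finite set (each `v` lies over ONE prime). [folklore] -/
theorem finite_primes_under_S : {pp : Nat.Primes | ∃ v ∈ X.S, ((pp : ℕ) : 𝓞 F) ∈ v.asIdeal}.Finite := by
  have hS : {pp : Nat.Primes | ∃ v ∈ X.S, ((pp : ℕ) : 𝓞 F) ∈ v.asIdeal} =
      ⋃ v ∈ (X.S : Set (HeightOneSpectrum (𝓞 F))), {pp : Nat.Primes | ((pp : ℕ) : 𝓞 F) ∈ v.asIdeal} := by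
    ext pp
    simp only [Set.mem_setOf_eq, Set.mem_iUnion, Finset.mem_coe, exists_prop]
  rw [hS]
  refine Set.Finite.biUnion X.S.finite_toSet fun v _ => Set.Subsingleton.finite ?_
  intro pp hpp qq hqq
  haveI : Fact (qq : ℕ).Prime := ⟨qq.2⟩
  exact Subtype.ext (eq_of_natCast_mem_of_prime (qq : ℕ) v.isPrime.ne_top pp.2 hpp hqq)

end Real

end Thm311

end IUTFork

end Summit.ABC

end
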